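import Summits.ABC.IUTFork.Cor312HullVolumePrVolScaled
import Summits.ABC.IUTFork.Cor312PilotIdelesPrCapstone
import Summits.ABC.IUTFork.Cor312SmallStableDHVolume
import Summits.ABC.IUTFork.Cor312Ind2BallsRamified
import Summits.ABC.IUTFork.Cor312SmallStablePrVol
import Summits.ABC.IUTFork.Thm311RealIsmDHNonIsometryMover
import Literature.IUT.LogVolume.TensorPacketVolume
import Literature.IUT.LogVolume.TensorPacketCapsuleRegion
import HarnessLib

/-!
# [IUTchIII] Cor. 3.12, statement — the (Ind1)/(Ind2)-hull has STRICTLY POSITIVE local Θ-volume at a RAMIFIED packet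
# of the print-normalised sharp setting of record, even where every Θ-box is the unit polydisc (idele-free inflation)

PROOF-ONLY file (abc-iut cell, Cor. 3.12 sub-crew, seat abc-iut-c312-5, gen 5; row «RAMIFIED-GAIN»); TAKES NO SIDE on
[IUTchIII] Cor. 3.12; no definition, no `Prop` fact, no instance. Companion of `Cor312HullVolumePrVolScaled` (p433308:
at an odd prime `p ∤ disc(F)` the local Θ-volume `−|log(Θ)|_{i+1,p}` of abc-iut-c312-7's `Real.settingPrVolSharp` is
EXACTLY `Σ_{v⃗} Pr(v⃗)·(−min_a m(v_a))·log p`, in particular `0` where the Θ-ideles are units) and the kernel VOLUME form of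
this seat's gen-4 hand finding F-c312-5-g4-1 (HOME/staging/c312/c312-5/g4/FINDING-hst-ramified.md): at a place `v | p`
with absolute ramification `2 ≤ e_v ≤ i+2` and a prime `p` NOT under `S` (all Θ-boxes over `p` = `𝒪_L`, all
(Ind3)-regions of log-volume `0`), **`thetaLocal_settingPrVolSharp_pos_of_ramified` : `0 < −|log(Θ)|_{i+1,p}`**.
Mechanism ([IUTchIII] Cor. 3.12 proof, kurims `paper:url-4b091feeb646` p. 174 l. 50 – p. 175 l. 1, "the holomorphic
hull of the union of the possible images"; Dupuy–Hilado §4.9 (Ind2) = lattice automorphisms of the log-shell): §0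
elementary lemmas (an automorphism moving a ball expands some vector or its inverse does; discreteness of
`p^{(1/e)ℤ}`; a `p`-power window); §1 `exists_mem_ismDH_norm_lt` — at `e_v ≥ 2` some `g ∈ Real.ismDH logv v`
(gen-4 `exists_mem_ismDH_image_closedBall_ne`, Literature `LatticeAutBalls`) EXPANDS a vector `z`; §2 the (Ind2)-family
`⊗_a g` at `v` carries the point `p^k·z^{⊗(i+2)}` of the unit box (`‖z‖^{i+2} ≤ p^k < ‖g z‖^{i+2}`) to a possible image
whose coordinate in EVERY field factor of the diagonal summand `F_v^{⊗(i+2)}` has norm `ρ = p^{-k}‖g z‖^{i+2} > 1`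
(campaign-S `norm_factorEmb`), so the hull — a hull-set `e⁻¹(λ·𝒪_L)` (`HullDefined`, abc-iut-c312-7
`thetaFinite_settingPrVolSharp`) containing `1` and that image — has radii `≥ 1` everywhere and `≥ ρ` on the diagonal
summand, and its probability-weighted log-volume (abc-iut-w4-d036 `sum_w_packetLogμ_factorMap_preimage_hullSet`) is
`≥ Pr(v,…,v)·log ρ > 0`. So abc-iut-w5-d082's excess `E` / abc-iut-w4-d107's `C(X, logv)` at the packets over
`2·disc(F)` bound a quantity that is genuinely POSITIVE at ramified packets: the typed hull raises `−|log(Θ)|` there with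
trivial ideles (the log-different phenomenon of [IUTchIV] Thm. 1.10 Step (v), in the Dupuy–Hilado reading), whereas at
odd unramified `p ∉ S` it is `0` (abc-iut-c312-7 `thetaLocal_settingPrVol_eq_zero`). HONEST SCOPE: Dupuy–Hilado's (Ind2)
(all shell-preserving lattice automorphisms of `I_v`), not print's Ism at every open subgroup; labels with `e_v ≤ i+2`
only (the argument's amplification); nothing asserted about [IUTchIII] Cor. 3.12. [cite: DupuyHilado2025, §3.6, §3.9, §4.9]
[cite: Mochizuki2012, IUTchIV Thm 1.10 proof Step (v) p. 27–28] [claim: Mochizuki2012, status: disputed]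
-/

noncomputable section

open Set Function NumberField IsDedekindDomain Metric
open scoped Pointwise

namespace Summit.ABC

namespace IUTFork

namespace Thm311

namespace Real

open Cor312 Cor312Vol Literature.IUT.LogThetaLattice Literature.IUT.LogVolume

/-! ## §0. Local lemmas: an automorphism that moves a ball expands some vector; discreteness and `p`-power windows -/

/-- **A linear automorphism that maps some closed ball centred at `0` onto a different set EXPANDS a vector, or its
inverse does**: if `‖φ x‖ ≤ ‖x‖` and `‖φ⁻¹ x‖ ≤ ‖x‖` for all `x`, then `φ` is an isometry and maps every closed ball
centred at `0` onto itself. [folklore] -/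
theorem exists_norm_lt_of_image_closedBall_ne {𝕜 E : Type*} [NormedField 𝕜] [SeminormedAddCommGroup E]
    [Module 𝕜 E] (φ : E ≃ₗ[𝕜] E) {r : ℝ} (h : φ '' closedBall (0 : E) r ≠ closedBall 0 r) :
    ∃ x : E, ‖x‖ < ‖φ x‖ ∨ ‖x‖ < ‖φ.symm x‖ := by
  by_contra hcon
  push Not at hcon
  have hiso : ∀ x, ‖φ x‖ = ‖x‖ := fun x =>
    le_antisymm (hcon x).1 (by simpa only [LinearEquiv.symm_apply_apply] using (hcon (φ x)).2)
  refine h (Set.Subset.antisymm ?_ ?_)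
  · rintro _ ⟨x, hx, rfl⟩
    rw [mem_closedBall_zero_iff] at hx ⊢
    rwa [hiso]
  · intro y hy
    refine ⟨φ.symm y, ?_, φ.apply_symm_apply y⟩
    rw [mem_closedBall_zero_iff] at hy ⊢
    rwa [← hiso, LinearEquiv.apply_symm_apply]

/-- **Discreteness of the value group `p^{(1/e)ℤ}`**: in a `p`-adic field `K` with absolute ramification index `e`,
`‖x‖ < ‖y‖` forces `p^{1/e}·‖x‖ ≤ ‖y‖`. [cite: NeukirchANT1999, Ch. II Prop. (5.5)] -/
theorem rpow_mul_norm_le_of_norm_lt (p : ℕ) [Fact p.Prime] {K : Type*} [NontriviallyNormedField K]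
    [NormedAlgebra ℚ_[p] K] [IsUltrametricDist K] [ProperSpace K] {x y : K} (hxy : ‖x‖ < ‖y‖) :
    (p : ℝ) ^ (1 / (absRamificationIdx p K : ℝ)) * ‖x‖ ≤ ‖y‖ := by
  have hp : (0 : ℝ) < p := by exact_mod_cast (Fact.out : p.Prime).pos
  have hy : y ≠ 0 := fun h0 => by rw [h0, norm_zero] at hxy; exact not_lt.mpr (norm_nonneg x) hxy
  have hy' : 0 < ‖y‖ := norm_pos_iff.mpr hy
  have hlt : ‖x * y⁻¹‖ < 1 := by
    rw [norm_mul, norm_inv, mul_inv_lt_iff₀ hy', one_mul]; exact hxy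
  have hle := norm_le_rpow_of_norm_lt_one p K hlt
  rw [norm_mul, norm_inv, mul_inv_le_iff₀ hy'] at hle
  calc (p : ℝ) ^ (1 / (absRamificationIdx p K : ℝ)) * ‖x‖
      ≤ (p : ℝ) ^ (1 / (absRamificationIdx p K : ℝ)) * ((p : ℝ) ^ (-(1 / (absRamificationIdx p K : ℝ))) * ‖y‖) :=
        mul_le_mul_of_nonneg_left hle (by positivity)
    _ = ‖y‖ := by
        rw [← mul_assoc, ← Real.rpow_add hp, add_neg_cancel, Real.rpow_zero, one_mul]

/-- **`p`-power amplification**: if `p^{1/e}·‖x‖ ≤ ‖y‖` with `x ≠ 0` and `e ≤ N`, then `p·‖x‖^N ≤ ‖y‖^N`. [folklore] -/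
theorem p_mul_pow_norm_le (p : ℕ) [Fact p.Prime] {K : Type*} [NormedField K] {x y : K} {e N : ℕ} (he : 0 < e)
    (heN : e ≤ N) (h : (p : ℝ) ^ (1 / (e : ℝ)) * ‖x‖ ≤ ‖y‖) :
    (p : ℝ) * ‖x‖ ^ N ≤ ‖y‖ ^ N := by
  have hp1 : (1 : ℝ) ≤ p := by exact_mod_cast (Fact.out : p.Prime).one_lt.le
  have hp0 : (0 : ℝ) ≤ p := zero_le_one.trans hp1
  have hpow := pow_le_pow_left₀ (by positivity) h N
  rw [mul_pow, ← Real.rpow_natCast, ← Real.rpow_mul hp0] at hpow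
  refine le_trans (mul_le_mul_of_nonneg_right ?_ (by positivity)) hpow
  have hexp : (1 : ℝ) ≤ 1 / (e : ℝ) * (N : ℝ) := by
    rw [one_div_mul_eq_div, le_div_iff₀ (by exact_mod_cast he), one_mul]
    exact_mod_cast heN
  calc (p : ℝ) = (p : ℝ) ^ (1 : ℝ) := (Real.rpow_one _).symm
    _ ≤ (p : ℝ) ^ (1 / (e : ℝ) * (N : ℝ)) := Real.rpow_le_rpow_of_exponent_le hp1 hexp

/-- **A `p`-power window**: if `p·A ≤ B` with `0 < A`, some integer power `p^k` satisfies `A ≤ p^k < B`. [folklore] -/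
theorem exists_zpow_mem_window (p : ℕ) [Fact p.Prime] {A B : ℝ} (hA : 0 < A) (hAB : (p : ℝ) * A ≤ B) :
    ∃ k : ℤ, A ≤ (p : ℝ) ^ k ∧ (p : ℝ) ^ k < B := by
  have hp1 : (1 : ℝ) < p := by exact_mod_cast (Fact.out : p.Prime).one_lt
  obtain ⟨n, hn1, hn2⟩ := exists_mem_Ioc_zpow hA hp1
  refine ⟨n + 1, hn2, lt_of_lt_of_le ?_ hAB⟩
  rw [zpow_add_one₀ (zero_lt_one.trans hp1).ne', mul_comm]
  exact mul_lt_mul_of_pos_left hn1 (zero_lt_one.trans hp1)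


/-! ## §1. The mover: a shell-preserving lattice automorphism of `F_v` that EXPANDS some vector (`e_v ≥ 2`) -/

variable {F : Type} [Field F] [NumberField F] (X : PilotData F) {logv : PadicLogs F} (hlog : LogvAnalytic logv)

open Literature.NumberTheory.NumberFields in
/-- **At a place `v | p` with `e_v ≥ 2` the typed (Ind2) group `Real.ismDH` contains a map EXPANDING some vector**
(gen-4 `exists_mem_ismDH_image_closedBall_ne` + §0; inverse via abc-iut-w5-d216 `NonIsometryMover.symm_mem_ismDH`), recorded with its `ℚ_p`-linear form `g'` on `K_v` and the
intertwining through the presentation. [cite: DupuyHilado2025, §4.9] -/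
theorem exists_mem_ismDH_norm_lt (pp : Nat.Primes) [Fact (pp : ℕ).Prime] (v : HeightOneSpectrum (𝓞 F))
    (hv : (thetaIndex X).over (.inr v) = .inr pp) (hvp : ((pp : ℕ) : 𝓞 F) ∈ v.asIdeal)
    (he : 2 ≤ absRamificationIdx (pp : ℕ) (RescaledCompletion F (pp : ℕ) v hvp)) :
    ∃ g ∈ ismDH logv (.inr v : Place F),
      ∃ g' : (presAt X hlog pp).k ⟨.inr v, hv⟩ ≃ₗ[ℚ_[pp]] (presAt X hlog pp).k ⟨.inr v, hv⟩,
        (∀ y, (presAt X hlog pp).φ ⟨.inr v, hv⟩ (g y) = g' ((presAt X hlog pp).φ ⟨.inr v, hv⟩ y)) ∧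
        ∃ z, ‖z‖ < ‖g' z‖ := by
  obtain ⟨g, hg, t, -, hball⟩ := exists_mem_ismDH_image_closedBall_ne (F := F) (pp : ℕ) (hlog pp) v hvp he
  obtain ⟨g', hg'⟩ := (presAt X hlog pp).ism_linear ⟨.inr v, hv⟩ g hg
  have hfun : (fun a => toR (pp : ℕ) v hvp (g (ofR (pp : ℕ) v hvp a))) = ⇑g' := funext fun a => hg' _
  rw [hfun] at hball
  obtain ⟨z, hz | hz⟩ := exists_norm_lt_of_image_closedBall_ne g' (hball t)
  · exact ⟨g, hg, g', hg', z, hz⟩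
  · refine ⟨g.symm, NonIsometryMover.symm_mem_ismDH logv v hg, g'.symm, fun y => ?_, z, hz⟩
    rw [LinearEquiv.eq_symm_apply, ← hg']
    exact congrArg _ (g.apply_symm_apply y)

/-! ## §2. The strictly positive local Θ-volume at a ramified packet with unit boxes -/

variable (M : Type) [Field M] [NumberField M]
  (archPk : ∀ (j : (thetaIndex X).Label) (vQ : (thetaIndex X).VQ), Set ((logShellsDH X logv).Packet j vQ))
  (archSub : ∀ (j : (thetaIndex X).Label) (v : (thetaIndex X).V),
    Set ((logShellsDH X logv).Packet j ((thetaIndex X).over v)))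
  (Ψ : ℤ → ∀ v : (thetaIndex X).V, v ∈ (thetaIndex X).Vbad → Set ((logShellsDH X logv).StarPacket v))
  (act : ℤ → ∀ v : (thetaIndex X).V, v ∈ (thetaIndex X).Vbad →
    (logShellsDH X logv).StarPacket v → Module.End ℚ ((logShellsDH X logv).StarPacket v))
  (Mmod : ℤ → ∀ j : (thetaIndex X).LabelStar, Set ((logShellsDH X logv).GlobalPacket j.1))
  (region : ℤ → ∀ j : (thetaIndex X).LabelStar, FinDivisor M → ∀ vQ : (thetaIndex X).VQ,
    Set ((logShellsDH X logv).Packet j.1 vQ))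
  (n : ℤ)
  (t : ∀ (pp : Nat.Primes) (_ : Fin X.lstar) (x : (thetaIndex X).Fibre (.inr pp)),
    haveI : Fact (pp : ℕ).Prime := ⟨pp.2⟩; kOf X pp.1 x)
  (tq : ∀ (pp : Nat.Primes) (x : (thetaIndex X).Fibre (.inr pp)),
    haveI : Fact (pp : ℕ).Prime := ⟨pp.2⟩; kOf X pp.1 x)
  {HT : Type} {LogLink : HT → HT → Type} {IsFull : ∀ {s t : HT}, LogLink s t → Prop}
  (lat : LGPGaussianLogThetaLattice LogLink IsFull)
  {Frd : Type} {IsoF : Frd → Frd → Type} {Ob : Frd → Type} {realify : Frd → Frd} {Strip : Type}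
  {IsoS : Strip → Strip → Type} {Mv : ∀ v : (thetaIndex X).V, v ∈ (thetaIndex X).Vbad → Type}
  [∀ v h, Monoid (Mv v h)]
  (sig : GlobalLGPFrobenioidSignature (thetaIndex X).lstar (thetaIndex X).V (· ∈ (thetaIndex X).Vbad)
    Frd IsoF Ob realify Strip IsoS Mv)
  (split : SplittingMonoids Mv) {ObΔ : Type} {N : ∀ v : (thetaIndex X).V, v ∈ (thetaIndex X).Vbad → Type}
  [∀ v h, Monoid (N v h)] (qData : QPilotData ObΔ N)

/-- `HullDefined` at every packet of the print-normalised sharp setting (from `ThetaFinite`, abc-iut-c312-7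
`thetaFinite_settingPrVolSharp`). [folklore] -/
theorem hullDefined_settingPrVolSharp (ht0 : ∀ pp i x, t pp i x ≠ 0)
    (ht1 : ∀ (pp : Nat.Primes) (i : Fin X.lstar) (x : (thetaIndex X).Fibre (.inr pp)),
      haveI : Fact (pp : ℕ).Prime := ⟨pp.2⟩; placeOf X pp.1 x ∉ X.S → ‖t pp i x‖ = 1)
    (htq0 : ∀ pp x, tq pp x ≠ 0)
    (htq1 : ∀ (pp : Nat.Primes) (x : (thetaIndex X).Fibre (.inr pp)),
      haveI : Fact (pp : ℕ).Prime := ⟨pp.2⟩; placeOf X pp.1 x ∉ X.S → ‖tq pp x‖ = 1)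
    (i : Fin (thetaIndex X).lstar) (vQ : (thetaIndex X).VQ) :
    (settingPrVolSharp X hlog M archPk archSub Ψ act Mmod region n lat sig split qData tq t htq0
      htq1).HullDefined (Setting.labelSucc i) vQ := by
  have h := (thetaFinite_settingPrVolSharp X hlog M archPk archSub Ψ act Mmod region n lat sig split qData t tq ht0 ht1
    htq0 htq1).1 i vQ
  by_contra hnd
  apply h
  unfold Setting.thetaLocal
  rw [if_neg hnd]

open Literature.NumberTheory.NumberFields in
/-- **STRICTLY POSITIVE local Θ-volume at a RAMIFIED packet with UNIT Θ-boxes**: at `Real.settingPrVolSharp`, for a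
prime `p` not under `S` and a place `v | p` of `F` with `2 ≤ e_v ≤ |S^±_{i+2}| = i+2`, `0 < −|log(Θ)|_{i+1,p}` — the typed
(Ind1)/(Ind2)-hull inflates although every (Ind3)-region there has log-volume `0` (module docstring for the mechanism;
kernel volume form of F-c312-5-g4-1). [cite: DupuyHilado2025, §3.9, §4.9] [claim: Mochizuki2012, status: disputed] -/
theorem thetaLocal_settingPrVolSharp_pos_of_ramified (ht0 : ∀ pp i x, t pp i x ≠ 0)
    (ht1 : ∀ (pp : Nat.Primes) (i : Fin X.lstar) (x : (thetaIndex X).Fibre (.inr pp)),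
      haveI : Fact (pp : ℕ).Prime := ⟨pp.2⟩; placeOf X pp.1 x ∉ X.S → ‖t pp i x‖ = 1)
    (htq0 : ∀ pp x, tq pp x ≠ 0)
    (htq1 : ∀ (pp : Nat.Primes) (x : (thetaIndex X).Fibre (.inr pp)),
      haveI : Fact (pp : ℕ).Prime := ⟨pp.2⟩; placeOf X pp.1 x ∉ X.S → ‖tq pp x‖ = 1)
    (i : Fin (thetaIndex X).lstar) (pp : Nat.Primes) [Fact (pp : ℕ).Prime]
    (hS : ∀ x : (thetaIndex X).Fibre (.inr pp), placeOf X pp.1 x ∉ X.S)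
    (v : HeightOneSpectrum (𝓞 F)) (hv : (thetaIndex X).over (.inr v) = .inr pp)
    (hvp : ((pp : ℕ) : 𝓞 F) ∈ v.asIdeal) (he : 2 ≤ absRamificationIdx (pp : ℕ) (RescaledCompletion F (pp : ℕ) v hvp))
    (hei : absRamificationIdx (pp : ℕ) (RescaledCompletion F (pp : ℕ) v hvp) ≤
      Fintype.card ((thetaIndex X).Caps (Setting.labelSucc i))) :
    0 < (settingPrVolSharp X hlog M archPk archSub Ψ act Mmod region n lat sig split qData tq t htq0
        htq1).thetaLocal (Setting.labelSucc i) (.inr pp) := by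
  classical
  have hp1 : (1 : ℝ) < (pp : ℕ) := by exact_mod_cast pp.2.one_lt
  have hp0 : (0 : ℝ) < (pp : ℕ) := zero_lt_one.trans hp1
  set x₀ : (thetaIndex X).Fibre (.inr pp) := ⟨.inr v, hv⟩ with hx₀
  set e₀ : (thetaIndex X).Caps (Setting.labelSucc i) → (thetaIndex X).Fibre (.inr pp) := fun _ => x₀ with he₀
  set Pset := settingPrVolSharp X hlog M archPk archSub Ψ act Mmod region n lat sig split qData tq t htq0 htq1
    with hPset
  haveI : Nonempty ((thetaIndex X).Caps (Setting.labelSucc i)) := ⟨0⟩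
  have h1 : ∀ x : (thetaIndex X).Fibre (.inr pp), ‖t pp i x‖ = 1 := fun x => ht1 pp i x (hS x)
  obtain ⟨g, hg, g', hgg', z, hz⟩ := exists_mem_ismDH_norm_lt X hlog pp v hv hvp he
  have hz0 : z ≠ 0 := fun h0 => by
    rw [h0, map_zero, norm_zero] at hz
    exact lt_irrefl _ hz
  have hzN : 0 < ‖z‖ ^ Fintype.card ((thetaIndex X).Caps (Setting.labelSucc i)) := pow_pos (norm_pos_iff.mpr hz0) _
  have hratio := rpow_mul_norm_le_of_norm_lt (pp : ℕ) (K := (presAt X hlog pp).k x₀) hz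
  have hpow : ((pp : ℕ) : ℝ) * ‖z‖ ^ Fintype.card ((thetaIndex X).Caps (Setting.labelSucc i)) ≤
      ‖g' z‖ ^ Fintype.card ((thetaIndex X).Caps (Setting.labelSucc i)) :=
    p_mul_pow_norm_le (pp : ℕ) (absRamificationIdx_pos (pp : ℕ) ((presAt X hlog pp).k x₀)) hei hratio
  obtain ⟨k, hk1, hk2⟩ := exists_zpow_mem_window (pp : ℕ) hzN hpow
  have hnk : ‖((pp : ℕ) : ℚ_[pp]) ^ k‖ = ((pp : ℕ) : ℝ) ^ (-k) := by
    rw [norm_zpow, Padic.norm_p, inv_zpow']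
  set ρ : ℝ := ((pp : ℕ) : ℝ) ^ (-k) * ‖g' z‖ ^ Fintype.card ((thetaIndex X).Caps (Setting.labelSucc i)) with hρ
  have hρ1 : 1 < ρ := by
    rw [hρ, zpow_neg, ← div_eq_inv_mul, one_lt_div (zpow_pos hp0 k)]
    exact hk2
  have hbox : ((pp : ℕ) : ℝ) ^ (-k) * ‖z‖ ^ Fintype.card ((thetaIndex X).Caps (Setting.labelSucc i)) ≤ 1 := by
    rw [zpow_neg, ← div_eq_inv_mul, div_le_one (zpow_pos hp0 k)]
    exact hk1
  set G : ∀ y : Place F, Carrier y ≃ₗ[ℚ] Carrier y :=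
    Function.update (fun y => LinearEquiv.refl ℚ (Carrier y)) (.inr v) g with hG
  have hGv : G (.inr v) = g := by rw [hG, Function.update_self]
  have hGmem : ∀ y : Place F, G y ∈ ismDH logv y := by
    intro y
    by_cases hy : y = .inr v
    · subst hy; rw [hGv]; exact hg
    · rw [hG, Function.update_of_ne hy]; exact refl_mem_ismDH logv y
  choose g'' hg'' using fun w : (thetaIndex X).Fibre (.inr pp) => (presAt X hlog pp).ism_linear w (G w.1) (hGmem w.1)
  set Φ : (logShellsDH X logv).PacketAut := fun j' vQ' =>
    (logShellsDH X logv).factorwise j' vQ' fun _ => (logShellsDH X logv).summandwise vQ' fun w => G w.1 with hΦ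
  have hΦ2 : Φ ∈ (logShellsDH X logv).Ind2Family := fun j' vQ' => ⟨fun _ w => G w.1, fun _ w => hGmem w.1, rfl⟩
  have hΦind : Φ ∈ Setting.indGroup (situationPrVol X hlog M archPk archSub Ψ act Mmod region) :=
    Subgroup.subset_closure (Or.inr hΦ2)
  have hcomp : ∀ x, (presAt X hlog pp).comparison (Setting.labelSucc i) (Φ (Setting.labelSucc i) (.inr pp) x) =
      fun e => (PiTensorProduct.congr fun a => g'' (e a) : (presAt X hlog pp).X e ≃ₗ[ℚ_[pp]] (presAt X hlog pp).X e)
        ((presAt X hlog pp).comparison (Setting.labelSucc i) x e) :=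
    fun x => (presAt X hlog pp).comparison_factorwise (fun _ w => G w.1) (fun _ w => g'' w) (fun _ w y => hg'' w y) x
  have hGx : ∀ y, G x₀.1 y = g y := fun y => by
    change G (.inr v) y = g y
    rw [hGv]
  have hagree : ∀ u, g'' x₀ u = g' u := by
    intro u
    obtain ⟨y, rfl⟩ := ((presAt X hlog pp).φ x₀).surjective u
    rw [← hg'' x₀ y, ← hgg' y]
    exact congrArg _ (hGx y)
  set u : (presAt X hlog pp).X e₀ := purePacket (pp : ℕ) ((presAt X hlog pp).kk e₀) fun _ => z with hu
  set w : (presAt X hlog pp).X e₀ := (((pp : ℕ) : ℚ_[pp]) ^ k) • u with hw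
  have hnorm_u : ∀ jj : DIdx (pp : ℕ) ((presAt X hlog pp).kk e₀), ‖dEquiv (pp : ℕ) ((presAt X hlog pp).kk e₀) u jj‖ =
      ‖z‖ ^ Fintype.card ((thetaIndex X).Caps (Setting.labelSucc i)) := by
    intro jj
    rw [hu, psi_purePacket_apply (pp : ℕ) ((presAt X hlog pp).kk e₀) (DFac (pp : ℕ) ((presAt X hlog pp).kk e₀))
      (dEquiv (pp : ℕ) ((presAt X hlog pp).kk e₀)), norm_prod]
    exact Finset.prod_eq_pow_card fun a _ =>
      norm_factorEmb (pp : ℕ) ((presAt X hlog pp).kk e₀) (DFac (pp : ℕ) ((presAt X hlog pp).kk e₀))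
        (dEquiv (pp : ℕ) ((presAt X hlog pp).kk e₀)) a jj _
  have hnorm_w : ∀ jj : DIdx (pp : ℕ) ((presAt X hlog pp).kk e₀), ‖dEquiv (pp : ℕ) ((presAt X hlog pp).kk e₀) w jj‖ =
      ((pp : ℕ) : ℝ) ^ (-k) * ‖z‖ ^ Fintype.card ((thetaIndex X).Caps (Setting.labelSucc i)) := by
    intro jj
    rw [hw, map_smul, Pi.smul_apply, norm_smul, hnk, hnorm_u]
  have hgu : (PiTensorProduct.congr fun a => g'' (e₀ a) :
        (presAt X hlog pp).X e₀ ≃ₗ[ℚ_[pp]] (presAt X hlog pp).X e₀) u =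
      purePacket (pp : ℕ) ((presAt X hlog pp).kk e₀) fun _ => g' z := by
    rw [hu, purePacket, purePacket, PiTensorProduct.congr_tprod]
    exact congrArg _ (funext fun a => hagree z)
  have hnorm_gw : ∀ jj : DIdx (pp : ℕ) ((presAt X hlog pp).kk e₀),
      ‖dEquiv (pp : ℕ) ((presAt X hlog pp).kk e₀) ((PiTensorProduct.congr fun a => g'' (e₀ a) :
        (presAt X hlog pp).X e₀ ≃ₗ[ℚ_[pp]] (presAt X hlog pp).X e₀) w) jj‖ = ρ := by
    intro jj
    rw [hw, map_smul, hgu, map_smul, Pi.smul_apply, norm_smul, hnk,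
      psi_purePacket_apply (pp : ℕ) ((presAt X hlog pp).kk e₀) (DFac (pp : ℕ) ((presAt X hlog pp).kk e₀))
        (dEquiv (pp : ℕ) ((presAt X hlog pp).kk e₀)), norm_prod, hρ]
    exact congrArg _ (Finset.prod_eq_pow_card fun a _ =>
      norm_factorEmb (pp : ℕ) ((presAt X hlog pp).kk e₀) (DFac (pp : ℕ) ((presAt X hlog pp).kk e₀))
        (dEquiv (pp : ℕ) ((presAt X hlog pp).kk e₀)) a jj _)
  have h3 : Pset.thetaRegion3 (Setting.labelSucc i) (.inr pp) =
      (fun x => (presAt X hlog pp).factorMap (Setting.labelSucc i) x) ⁻¹'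
        hullSet ((presAt X hlog pp).factorField (Setting.labelSucc i)) (fun _ => 1) := by
    rw [hPset, settingPrVolSharp, thetaRegion3_settingPrVol, iUnion_thetaBoxDH_sharp,
      thetaBoxDH_sharp_eq_hullSet_one X hlog t ht0 i pp h1]
    rfl
  have hmem3 : ∀ y : (logShellsDH X logv).Packet (Setting.labelSucc i) (.inr pp),
      (∀ e jj, ‖dEquiv (pp : ℕ) ((presAt X hlog pp).kk e) ((presAt X hlog pp).comparison (Setting.labelSucc i) y e) jj‖
        ≤ 1) → y ∈ Pset.thetaRegion3 (Setting.labelSucc i) (.inr pp) := by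
    intro y hy
    rw [h3]
    change (presAt X hlog pp).factorMap (Setting.labelSucc i) y ∈
      hullSet ((presAt X hlog pp).factorField (Setting.labelSucc i)) (fun _ => 1)
    rw [hullSet, mem_polydisc]
    rintro ⟨e, jj⟩
    rw [norm_one]
    exact hy e jj
  obtain ⟨x, hx⟩ := (presAt X hlog pp).comparison_surjective (Setting.labelSucc i) (Pi.single e₀ w)
  have hx3 : x ∈ Pset.thetaRegion3 (Setting.labelSucc i) (.inr pp) := by
    refine hmem3 x fun e jj => ?_
    rw [hx]
    by_cases hee : e = e₀
    · subst hee
      rw [Pi.single_eq_same, hnorm_w]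
      exact hbox
    · rw [Pi.single_eq_of_ne hee, map_zero, Pi.zero_apply, norm_zero]
      exact zero_le_one
  obtain ⟨x₁, hx₁⟩ := (presAt X hlog pp).comparison_surjective (Setting.labelSucc i) (fun _ => 1)
  have hx₁3 : x₁ ∈ Pset.thetaRegion3 (Setting.labelSucc i) (.inr pp) := by
    refine hmem3 x₁ fun e jj => ?_
    simp only [hx₁, map_one, Pi.one_apply, norm_one, le_refl]
  have hHD := hullDefined_settingPrVolSharp X hlog M archPk archSub Ψ act Mmod region n t tq lat sig split qData ht0 ht1
    htq0 htq1 i (.inr pp)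
  have hmemHul : Pset.thetaHull (Setting.labelSucc i) (.inr pp) ∈
      ((HullFrame.ofLocalFields (factorFieldDH X hlog (Setting.labelSucc i) (.inr pp))).comap
        (factorMapDH X hlog (Setting.labelSucc i) (.inr pp))).Hul :=
    (Pset.frame (Setting.labelSucc i) (.inr pp)).hull_mem_of_hasHull hHD.1 hHD.2
  obtain ⟨H', ⟨c, hc0, rfl⟩, hEq⟩ := hmemHul
  have hsub : ⋃₀ Pset.possibleImages (Setting.labelSucc i) (.inr pp) ⊆ Pset.thetaHull (Setting.labelSucc i) (.inr pp) :=
    (Pset.frame (Setting.labelSucc i) (.inr pp)).subset_hull _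
  have hmemc : ∀ y ∈ Pset.thetaHull (Setting.labelSucc i) (.inr pp), ∀ e jj,
      ‖dEquiv (pp : ℕ) ((presAt X hlog pp).kk e) ((presAt X hlog pp).comparison (Setting.labelSucc i) y e) jj‖ ≤
        ‖c ⟨e, jj⟩‖ := by
    intro y hy e jj
    rw [hEq] at hy
    change factorMapDH X hlog (Setting.labelSucc i) (.inr pp) y ∈
      hullSet (factorFieldDH X hlog (Setting.labelSucc i) (.inr pp)) c at hy
    rw [hullSet, mem_polydisc] at hy
    exact hy ⟨e, jj⟩
  have hc1 : ∀ s : (presAt X hlog pp).factorIdx (Setting.labelSucc i), 1 ≤ ‖c s‖ := by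
    rintro ⟨e, jj⟩
    have h := hmemc x₁ (hsub (Pset.thetaRegion3_subset_sUnion (Setting.labelSucc i) (.inr pp) hx₁3)) e jj
    simp only [hx₁, map_one, Pi.one_apply, norm_one] at h
    exact h
  have himg : Φ (Setting.labelSucc i) (.inr pp) '' Pset.thetaRegion3 (Setting.labelSucc i) (.inr pp) ∈
      Pset.possibleImages (Setting.labelSucc i) (.inr pp) := ⟨Φ, hΦind, rfl⟩
  have hcρ : ∀ jj : DIdx (pp : ℕ) ((presAt X hlog pp).kk e₀), ρ ≤ ‖c ⟨e₀, jj⟩‖ := by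
    intro jj
    have hΦx : Φ (Setting.labelSucc i) (.inr pp) x ∈ ⋃₀ Pset.possibleImages (Setting.labelSucc i) (.inr pp) :=
      Set.subset_sUnion_of_mem himg (Set.mem_image_of_mem _ hx3)
    have h := hmemc _ (hsub hΦx) e₀ jj
    simp only [hcomp x, hx, Pi.single_eq_same, hnorm_gw] at h
    exact h
  -- §2e: the volume, read in the probability-weighted container on the hull-set `e⁻¹(λ·𝒪_L)`
  unfold Setting.thetaLocal
  rw [if_pos hHD, hEq]
  have hvol := (presAtPr X hlog pp).sum_w_packetLogμ_factorMap_preimage_hullSet (Setting.labelSucc i) c hc0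
  change ((situationPrVol X hlog M archPk archSub Ψ act Mmod region).D n).logvol (Setting.labelSucc i) (.inr pp)
      ((fun x => (presAtPr X hlog pp).factorMap (Setting.labelSucc i) x) ⁻¹'
        hullSet ((presAtPr X hlog pp).factorField (Setting.labelSucc i)) c) = _ at hvol
  change (0 : WithTop ℝ) < ((((situationPrVol X hlog M archPk archSub Ψ act Mmod region).D n).logvol
      (Setting.labelSucc i) (.inr pp) ((fun x => (presAtPr X hlog pp).factorMap (Setting.labelSucc i) x) ⁻¹'
        hullSet ((presAtPr X hlog pp).factorField (Setting.labelSucc i)) c) : ℝ) : WithTop ℝ)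
  rw [WithTop.coe_pos, hvol]
  -- every summand is `≥ 0` (all radii `≥ 1`); the diagonal one is a sum of POSITIVE terms (radii `≥ ρ > 1`)
  refine lt_of_lt_of_le ?_ (Finset.single_le_sum (fun e _ => Finset.sum_nonneg fun jj _ =>
    mul_nonneg (mul_nonneg (weightPr_nonneg X pp.1 _ e) (by positivity)) (Real.log_nonneg (hc1 ⟨e, jj⟩)))
    (@Finset.mem_univ _ ((presAtPr X hlog pp).toLocalPieces.instFintype (Setting.labelSucc i)) e₀))
  exact Finset.sum_pos (fun jj _ => mul_pos (mul_pos (weightPr_pos X pp.1 _ e₀) (mul_pos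
      (inv_pos.mpr (by exact_mod_cast packetDegree_pos _ _))
      (mul_pos (by exact_mod_cast absRamificationIdx_pos _ _) (by exact_mod_cast residueDegree_pos _ _))))
    ((Real.log_pos hρ1).trans_le (Real.log_le_log (zero_lt_one.trans hρ1) (hcρ jj)))) Finset.univ_nonempty

end Real

end Thm311

end IUTFork

end Summit.ABC

end
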